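import Summits.QuantumFields.YangMills.Theorems.BalabanUVNodesN19LedgerDressAtRecord
import Summits.QuantumFields.YangMills.Theorems.BalabanUVNodesN19ClassMeasurePushforward

/-!
# BalabanUVNodes ∕ N19 (NE7 proper) — THE `hrep`-FREE ROAD-(i)-DRESSED N19 EDGE FOR F3's CLASS WEIGHTS AT THE UNIT READING: module 30's
# `coreEdge_classWeightOfDatum₉_of_vacuumLedgerAtSync_rep` with REP⁰ DISCHARGED by module 31's `map_relabel_iter_classMeasureOfSlots` — reading space = the unit-lattice fields,
# reference measure = their Haar measure, `fld := id`; what is left of REP⁰ is the a.e. IDENTIFICATION of NODE O's ledger integrand with def-T's vacuum class density read through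
# the relabelling (lens decomp v9 ROW REP-REC, corollary `…_unitReading`)

Cell `pub-ymgap` (HUMAN RULING D-0062, Track A), R134 ACCELERATION seat `pub-ymgap-dag-n19-d` (strategy s2), gen 7, module 31b (the corollary half of lens v9 ROW REP-REC; INBOX l.17426).
Filed `--kind proof --supports stmt-QuantumFields-20292 --as helper` (K3⁗).  COUNT-NEUTRAL.  THEOREMS ONLY; no Theses import; edits nothing.

WHAT IS PROVED ([bookkeeping]).
* §0 `unitFactorisation_A_eq_relabel_iter` — lens v9 kill-test (k3) PASSES in the kernel: t4's canonical `T4RunLadder.unitFactorisation`'s key map of run `K` IS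
  `relabel (bondShift (sitesPerDir_unit F K)) ∘ Averaging.iter (avOfRecord F N K) K` at any datum with the record's averaging (`D.av K = avOfRecord F N K`; `rfl` + one rewrite).
* `hrep_of_unitReading` — REP⁰ for one run and one class, at the UNIT READING: if the run's unit-factorisation key map factors through the iterated averaging of record along a bond
  relabelling onto the unit lattice, `Nf.A p.K = relabel ε ∘ Averaging.iter (avOfRecord F N p.K) k` (`hA`; lens kill-test (k3) is whether `T4RunLadder.unitFactorisation`'s `A` unfolds
  so — NOT decided here, displayed), and the ledger's integrand `f` is a.e.-EQUAL on the unit-lattice Haar measure to def-T's vacuum class density `(χ_k(s)·mass_k(s)) ∘ relabel ε.symm`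
  (`hdens` — NODE O's (2.23) representation content, displayed), then module 30's `hrep` holds with `μ := fieldMeasure (F.P 0) 0 (SU N)`, `fld := id` (module 31
  `map_relabel_iter_classMeasureOfSlots` + `withDensity_congr_ae` + `Measure.map_id`).
* ★ `coreEdge_classWeightOfDatum₉_of_vacuumLedgerAtSync_unitReading` — module 30's edge with `hrepA`∕`hrepB` REPLACED by `hAA hAB` (factorisations) + `hdensA hdensB` (a.e.
  identifications) + `hμ` (the ledger's reference measure IS the unit-lattice Haar measure on the good classes): NODE O's VACUUM `LedgerAtSync` on the undressed class weights + the
  in-edges BY NAME ⇒ `∃ δ, Spine.NE7.Core … (dressed class weights, run A) (run B) δ ∧ Summable δ`.  So NODE O owes N19 on road (i)-dressed the vacuum ledger ALONE (reference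
  measure fixed to unit-lattice Haar), plus the two definitional identifications.

HONEST FRAMING.  ZERO ESTIMATE CONTENT; the vacuum ledger, `hA`, `hdens`, `hμ` are HYPOTHESES (NODE O's instance is inhabited by nobody in the tree); valid at the identity selector;
nothing of Bałaban's asserted; NE7 NOT proved; N19 NOT discharged (0∕1); K3⁗ NOT claimed; counts UNMOVED; one finite four-torus programme at fixed `ε` — NOT ℝ⁴ ∕ OS ∕ mass gap ∕ Clay.
0 `def`, 0 `sorry`; no decl below carries a cite tag.
-/

set_option autoImplicit false

noncomputable section

open Finset MeasureTheory ProbabilityTheory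
open scoped BigOperators ENNReal Matrix.Norms.L2Operator

namespace Summit.QuantumFields.YangMills.BalabanUVNodes.N19LedgerDressAtRecordUnit

open Literature.MathematicalPhysics.QuantumFieldTheory.Balaban1983to89
open Literature.MathematicalPhysics.QuantumFieldTheory.Balaban1983to89.Node00
open T4Continuum B14.Eq218Concrete
open T4AveragingDisintegration hiding SU
open T4OutputRate T4RecentScale T4GoodClassBudget T4CauchySum T4TowerRateComposition T4TowerRateDischarge
open T4EtaRateMin (Readings NE3Shape)
open T4RateLiaison (GaugeDominated)
open Summit.QuantumFields.BalabanUV.T4Continuum.Spine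
open Summit.QuantumFields.YangMills.BalabanUVNodes.N19MGFKernelTower (classMeasureOfSlots slotMeasure slotMeasure_univ_lt_top)
open Summit.QuantumFields.YangMills.BalabanUVNodes.N19LedgerLinkSync (LedgerDataSync LedgerAtSync)
open Summit.QuantumFields.YangMills.BalabanUVNodes.N19LedgerDressAtRecord (coreEdge_classWeightOfDatum₉_of_vacuumLedgerAtSync_rep)
open Summit.QuantumFields.YangMills.BalabanUVNodes.N19ClassMeasurePushforward (map_relabel_iter_classMeasureOfSlots)

variable {F : T4Family} {N : ℕ} [NeZero N]

/-! ## §0 Lens v9 kill-test (k3) in the kernel: the canonical unit factorisation's key map IS a relabelling of the full iterated averaging -/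

/-- **(k3) PASSES**: for t4's canonical unit factorisation `T4RunLadder.unitFactorisation D hD g₀`, the key map of run `K` is `unitShift K ∘ Averaging.iter (D.av K) K`
(`rfl`), and `unitShift K = fieldShift (sitesPerDir_unit F K)` IS the bond relabelling `relabel (bondShift (sitesPerDir_unit F K))` — both are `fun U b ↦ U (ε b)` — so at any datum whose
averaging of run `K` is the record's (`D.av K = avOfRecord F N K`, e.g. `Node00.av_datumOfRecord₁₃Sep`) the key map is `relabel ε ∘ Averaging.iter (avOfRecord F N K) K` with
`ε := bondShift (sitesPerDir_unit F K) : PBond (F.P 0) 0 ≃ PBond (F.P K) K`: the shape module 31's `map_relabel_iter_classMeasureOfSlots` consumes, at the TOP slot level `k = K`. [folklore] -/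
theorem unitFactorisation_A_eq_relabel_iter (D : FiniteEpsData F (SU N)) (hD : D.AvgMeasurable) (g₀ : ℕ → ℝ) (K : ℕ) (hav : D.av K = avOfRecord F N K) :
    (T4RunLadder.unitFactorisation D hD g₀).A K =
      relabel (T4LevelShift.bondShift (T4LevelShift.sitesPerDir_unit F K)) ∘ Averaging.iter (avOfRecord F N K) K := by
  funext U
  rw [← hav]
  rfl

/-! ## §1 REP⁰ at the unit reading from the factorisation of the key map and the a.e. identification of the integrand -/

/-- **REP⁰ AT THE UNIT READING** [bookkeeping]: `hA` (the key map factors through the iterated averaging along the relabelling `ε`) + `hdens` (the ledger integrand `f` is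
a.e. def-T's vacuum class density read through `ε`) ⇒ module 30's `hrep` with `μ := fieldMeasure (F.P 0) 0 (SU N)`, `fld := id` (module 31 `map_relabel_iter_classMeasureOfSlots`). [folklore] -/
theorem hrep_of_unitReading {ν : Stage7Numerics} {τ : TowerNumerics} {w : StepWeightsOfRecord F N ν τ.M} {p : B12.RunParams} {g : ℕ → ℝ}
    (hwm : ∀ k s', Measurable fun z : GaugeField (F.P p.K) (k + 1) (SU N) × GaugeField (F.P p.K) k (SU N) => w p g k s' z.2 z.1)
    (hχm : ∀ k s, Measurable (chiSeqOfRecord F N ν τ.M g p.K k s)) {b : GaugeField (F.P p.K) 0 (SU N) → ℝ} (hbm : Measurable b)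
    (k : ℕ) (s : SeqOfRecord F ν τ.M g p.K k) (ε : PBond (F.P 0) 0 ≃ PBond (F.P p.K) k)
    {A : GaugeField (F.P p.K) 0 (SU N) → GaugeField (F.P 0) 0 (SU N)} (hA : A = relabel ε ∘ Averaging.iter (avOfRecord F N p.K) k)
    {f : GaugeField (F.P 0) 0 (SU N) → ℝ}
    (hdens : f =ᵐ[fieldMeasure (F.P 0) 0 (SU N)] fun V' =>
      (ENNReal.ofReal (chiSeqOfRecord F N ν τ.M g p.K k s (relabel ε.symm V')) * slotMeasure F N ν τ w p g b k s (relabel ε.symm V') Set.univ).toReal) :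
    (classMeasureOfSlots F N ν τ w p g b k s).map A =
      ((fieldMeasure (F.P 0) 0 (SU N)).withDensity fun v => ENNReal.ofReal (f v)).map id := by
  rw [Measure.map_id, hA, map_relabel_iter_classMeasureOfSlots hwm hχm hbm k s ε]
  refine withDensity_congr_ae (hdens.mono fun V' hV' => ?_)
  have hfin : ENNReal.ofReal (chiSeqOfRecord F N ν τ.M g p.K k s (relabel ε.symm V')) *
      slotMeasure F N ν τ w p g b k s (relabel ε.symm V') Set.univ ≠ ⊤ :=
    ENNReal.mul_ne_top ENNReal.ofReal_ne_top (slotMeasure_univ_lt_top b k s _).ne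
  show ENNReal.ofReal (chiSeqOfRecord F N ν τ.M g p.K k s (relabel ε.symm V')) *
      slotMeasure F N ν τ w p g b k s (relabel ε.symm V') Set.univ = ENNReal.ofReal (f V')
  rw [hV', ENNReal.ofReal_toReal hfin]

/-! ## §2 The `hrep`-free edge -/

section Edge

variable {C : Carriers} [DecidableEq C.Dom] {F' : Type*} {X : Type} {σ : Type*} [DecidableEq σ]
  {L : LedgerDataSync C F' (GaugeField (F.P 0) 0 (SU N)) σ} {l₀ vol : ℝ} {T : ℕ → Finset σ} {Bad : ℕ → ℝ → Finset σ}
  {R : Readings (GaugeField (F.P 0) 0 (SU N)) X} {W : Set (ℕ → ℝ)} {EA : Functional C C.BgA} {EB : Functional C C.BgB}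
  {κ θ₅ C₅ C₉ ω θc Cd γ C₃ θ₃ Pg : ℝ} {q : ℕ} {Λm : ℕ → ℕ → ℝ} {CU : (ℕ → ℝ) → ℕ → ℝ}
  {gc : ℕ → ℕ → ℝ} {uA : ℕ → GaugeField (F.P 0) 0 (SU N) → C.BgA} {uB : ℕ → GaugeField (F.P 0) 0 (SU N) → C.BgB}

/-- **★ THE `hrep`-FREE ROAD-(i)-DRESSED N19 EDGE FOR F3's CLASS WEIGHTS, UNIT READING** [bookkeeping] (module 30 `coreEdge_classWeightOfDatum₉_of_vacuumLedgerAtSync_rep` with REP⁰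
supplied by §1): NODE O's synchronised VACUUM ledger `hL` (reading space = the unit-lattice fields, reference measure = their Haar measure on the good classes `hμ`, cores = the UNDRESSED class
weights of the two runs), the in-edges BY NAME, the factorisations `hAA`∕`hAB` of the two runs' key maps through the iterated averagings along relabellings `εA K`∕`εB K`, and the a.e.
identifications `hdensA`∕`hdensB` of the ledger integrands with def-T's vacuum class densities (+ the integrands' measurability∕nonnegativity) ⇒ `∃ δ, Spine.NE7.Core l₀ vol T Bad P Q δ ∧ Summable δ`
for the DRESSED class weights.  Every binder a HYPOTHESIS (0∕1); NOT NE7. [folklore] -/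
theorem coreEdge_classWeightOfDatum₉_of_vacuumLedgerAtSync_unitReading (ϑ : Stage9Params F N) (hsel : ϑ.ppSel = ppSelIdOfRecord F ϑ.ν ϑ.τ9.M)
    (hw0 : ∀ p g k s' U V', 0 ≤ wOfRecord₉ F N ϑ p g k s' U V')
    (hwm : ∀ (p : B12.RunParams) (g : ℕ → ℝ) k s',
      Measurable fun z : GaugeField (F.P p.K) (k + 1) (SU N) × GaugeField (F.P p.K) k (SU N) => wOfRecord₉ F N ϑ p g k s' z.2 z.1)
    (hχm : ∀ (p : B12.RunParams) (g : ℕ → ℝ) k s, Measurable (chiSeqOfRecord F N ϑ.ν ϑ.τ9.M g p.K k s))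
    (D : FiniteEpsData F (SU N)) (hD : D.AvgMeasurable) (g₀ : ℕ → ℝ) (os : List (ULoop F))
    (Nf : T4VarianceMatching.UnitFactorisation (D.scheme g₀) (GaugeField (F.P 0) 0 (SU N)))
    (pA pB : ℕ → B12.RunParams) (gA gB : ℕ → ℕ → ℝ) (kA kB : ℕ → ℕ)
    (eA : ∀ K, σ → SeqOfRecord F ϑ.ν ϑ.τ9.M (gA K) (pA K).K (kA K)) (eB : ∀ K, σ → SeqOfRecord F ϑ.ν ϑ.τ9.M (gB K) (pB K).K (kB K))
    (hL : LedgerAtSync L l₀ vol T Bad (fun K _ τ => classWeightOfDatum₉ F N ϑ D g₀ os (pA K) (gA K) (kA K) 0 (eA K τ))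
      (fun K _ τ => classWeightOfDatum₉ F N ϑ D g₀ os (pB K) (gB K) (kB K) 0 (eB K τ)) R EA EB κ gc uA uB ω θc θ₅ θ₃)
    (h16 : NE3Shape R C₃ θ₃) (hC₃ : 0 ≤ C₃) (hgd : GaugeDominated R uA uB)
    (h18 : NE5 EA EB W κ θ₅ C₅) (hθ₅ : 0 ≤ θ₅) (hC₅ : 0 ≤ C₅)
    (h22 : NE9 EA W κ Λm ∧ T4OutputRate.FadingMemory C₉ ω Λm) (hω : 0 ≤ ω)
    (hinj : InjectedRate Cd 0 θc (fun K j => T4CouplingMatching.disc (gc K) (gc (K + 1)) j)) (hCd : 0 ≤ Cd)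
    (hθc : 0 ≤ θc) (hbox : ∀ K i, i ≤ K → 0 < gc K i ∧ gc K i ≤ γ)
    (hU : LipBackground EA W κ CU) (hG : PolyLipGrowth CU gc Pg q) (hPg : 0 ≤ Pg)
    (hgA : ∀ K, gc K ∈ W) (hgB : ∀ K, (fun i => gc (K + 1) (i + 1)) ∈ W)
    (hμ : ∀ K t, |t| ≤ l₀ → ∀ τ ∈ T K \ Bad K t, L.μ K t τ = fieldMeasure (F.P 0) 0 (SU N))
    (εA : ∀ K, PBond (F.P 0) 0 ≃ PBond (F.P (pA K).K) (kA K)) (εB : ∀ K, PBond (F.P 0) 0 ≃ PBond (F.P (pB K).K) (kB K))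
    (hAA : ∀ K, Nf.A (pA K).K = relabel (εA K) ∘ Averaging.iter (avOfRecord F N (pA K).K) (kA K))
    (hAB : ∀ K, Nf.A (pB K).K = relabel (εB K) ∘ Averaging.iter (avOfRecord F N (pB K).K) (kB K))
    (hfmA : ∀ K t, |t| ≤ l₀ → ∀ τ ∈ T K \ Bad K t,
      Measurable fun v => (∏ Xd ∈ L.fac K t τ, Real.exp (EA (gc K) (uA K v) Xd - EA (gc K) L.oneA Xd)) * L.oA K t τ v)
    (hf0A : ∀ K t, |t| ≤ l₀ → ∀ τ ∈ T K \ Bad K t, ∀ v,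
      0 ≤ (∏ Xd ∈ L.fac K t τ, Real.exp (EA (gc K) (uA K v) Xd - EA (gc K) L.oneA Xd)) * L.oA K t τ v)
    (hdensA : ∀ K t, |t| ≤ l₀ → ∀ τ ∈ T K \ Bad K t,
      (fun v => (∏ Xd ∈ L.fac K t τ, Real.exp (EA (gc K) (uA K v) Xd - EA (gc K) L.oneA Xd)) * L.oA K t τ v)
        =ᵐ[fieldMeasure (F.P 0) 0 (SU N)] fun V' =>
          (ENNReal.ofReal (chiSeqOfRecord F N ϑ.ν ϑ.τ9.M (gA K) (pA K).K (kA K) (eA K τ) (relabel (εA K).symm V')) *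
            slotMeasure F N ϑ.ν ϑ.τ9 (wOfRecord₉ F N ϑ) (pA K) (gA K) (Missing.boltzmann (F.P (pA K).K) ((g₀ (pA K).K)⁻¹ ^ 2)) (kA K) (eA K τ)
              (relabel (εA K).symm V') Set.univ).toReal)
    (hfmB : ∀ K t, |t| ≤ l₀ → ∀ τ ∈ T K \ Bad K t,
      Measurable fun v => (∏ Xd ∈ L.fac K t τ,
        Real.exp (EB (fun i => gc (K + 1) (i + 1)) (uB K v) Xd - EB (fun i => gc (K + 1) (i + 1)) L.oneB Xd)) * L.oB K t τ v)
    (hf0B : ∀ K t, |t| ≤ l₀ → ∀ τ ∈ T K \ Bad K t, ∀ v,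
      0 ≤ (∏ Xd ∈ L.fac K t τ,
        Real.exp (EB (fun i => gc (K + 1) (i + 1)) (uB K v) Xd - EB (fun i => gc (K + 1) (i + 1)) L.oneB Xd)) * L.oB K t τ v)
    (hdensB : ∀ K t, |t| ≤ l₀ → ∀ τ ∈ T K \ Bad K t,
      (fun v => (∏ Xd ∈ L.fac K t τ,
          Real.exp (EB (fun i => gc (K + 1) (i + 1)) (uB K v) Xd - EB (fun i => gc (K + 1) (i + 1)) L.oneB Xd)) * L.oB K t τ v)
        =ᵐ[fieldMeasure (F.P 0) 0 (SU N)] fun V' =>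
          (ENNReal.ofReal (chiSeqOfRecord F N ϑ.ν ϑ.τ9.M (gB K) (pB K).K (kB K) (eB K τ) (relabel (εB K).symm V')) *
            slotMeasure F N ϑ.ν ϑ.τ9 (wOfRecord₉ F N ϑ) (pB K) (gB K) (Missing.boltzmann (F.P (pB K).K) ((g₀ (pB K).K)⁻¹ ^ 2)) (kB K) (eB K τ)
              (relabel (εB K).symm V') Set.univ).toReal) :
    ∃ δ : ℕ → ℝ, NE7.Core l₀ vol T Bad (fun K t τ => classWeightOfDatum₉ F N ϑ D g₀ os (pA K) (gA K) (kA K) t (eA K τ))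
      (fun K t τ => classWeightOfDatum₉ F N ϑ D g₀ os (pB K) (gB K) (kB K) t (eB K τ)) δ ∧ Summable δ := by
  refine coreEdge_classWeightOfDatum₉_of_vacuumLedgerAtSync_rep ϑ hsel hw0 hwm hχm D hD g₀ os Nf pA pB gA gB kA kB eA eB hL h16 hC₃ hgd h18
    hθ₅ hC₅ h22 hω hinj hCd hθc hbox hU hG hPg hgA hgB measurable_id hfmA hf0A (fun K t ht τ hτ => ?_) hfmB hf0B (fun K t ht τ hτ => ?_)
  · rw [hμ K t ht τ hτ]
    exact hrep_of_unitReading (hwm _ _) (hχm _ _) (Missing.measurable_boltzmann RegularGaugeGroup.measurable_reTr (F.P (pA K).K) _)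
      (kA K) (eA K τ) (εA K) (hAA K) (hdensA K t ht τ hτ)
  · rw [hμ K t ht τ hτ]
    exact hrep_of_unitReading (hwm _ _) (hχm _ _) (Missing.measurable_boltzmann RegularGaugeGroup.measurable_reTr (F.P (pB K).K) _)
      (kB K) (eB K τ) (εB K) (hAB K) (hdensB K t ht τ hτ)

end Edge

end Summit.QuantumFields.YangMills.BalabanUVNodes.N19LedgerDressAtRecordUnit

end
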